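import Summits.QuantumFields.YangMills.Theorems.LangevinControlUVFemtoCurvatureTwoPointCDoublingKoszul
import Summits.QuantumFields.YangMills.Theorems.LangevinControlUVFemtoCurvatureTwoPointCDoublingPlaquette
import Summits.QuantumFields.YangMills.Theorems.LangevinControlUVFemtoCurvatureTwoPointCDoublingConeAlgebra
import HarnessLib

/-!
# Crux `FemtoCurvatureTwoPointC` (stmt-QuantumFields-16204), line `Sketch`, v7 — the cone estimate, per plaquette

Lead's package behind `stub_sublevelDoubling`, file P3b (`--supports stmt-QuantumFields-16204`). At a flat `τ`, for a chart point
`cfg τ (C + B)` with `C` a constant form and `B` any 1-form (components of norm `≤ 1/4`), the plaquette holonomy decomposes as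

  `ρ U_{x;ij} − 1 = α + β + ℰ`,  `α = e^{c_i} e^{c_j} e^{−c_i} e^{−c_j} − 1` (the group commutator of the zero modes `c_• = M C(x,•)`),
  `β = M (dOne τ B i j x)` (the linearised curvature), `‖ℰ‖ ≤ 3 σ (b₁+b₂+b₃+b₄)` (`norm_hol_sub_one_sub_sub_le`),

the commutator field `α` is covariantly constant (`comm_covariant`) so its cross term with `β` sums to zero over the sites
(`sum_re_trace_comm_dOne`), and `¼‖[c_i,c_j]‖ ≤ ‖α‖ ≤ ‖[c_i,c_j]‖` (`stub_expCommutatorBracket`). Consequences per plaquette: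
`‖ρU − 1‖² ≥ ½‖α+β‖² − ‖ℰ‖²` and `‖ρU − 1‖² ≤ 3(‖α‖² + ‖β‖² + ‖ℰ‖²)`. Everything here is proved; no definitions.
-/

set_option autoImplicit false

noncomputable section

open scoped Matrix Matrix.Norms.Frobenius InnerProductSpace
open NormedSpace
open Literature.MathematicalPhysics.QuantumLattice Literature.MathematicalPhysics.QuantumFieldTheory
open Summit.QuantumFields.YangMills.Theorems.FreeEnergyLogCoefficient

namespace Summit.QuantumFields.YangMills.Theorems.FemtoCurvatureTwoPointC.Doubling

variable {G : Type} [Group G] [TopologicalSpace G] [CompactSpace G] (r : LatticeRep G) {L : ℕ}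

/-! ### The commutator field of a constant form -/

/-- The zero-mode link variables of a constant form transport trivially: `M (Ad τ(x,i) C(x+e_i, j)) = M C(x, j)`. -/
theorem lieIso_adFib_const {τ : GaugeConfig 4 L G} {C : OneForm r L} (hC : C ∈ constForms r τ) (x : Site 4 L)
    (i j : Fin 4) : lieIso r.ρ (adFib r (τ (x, i)) (C (x.shift i, j))) = lieIso r.ρ (C (x, j)) := by
  rw [adFib_apply_of_mem_constForms r hC]

/-- Covariance of the exponentials of the zero modes: `e^{M C(x,j)} = ρτ(x,l) e^{M C(x+e_l, j)} ρτ(x,l)⁻¹`. -/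
theorem exp_const_covariant {τ : GaugeConfig 4 L G} {C : OneForm r L} (hC : C ∈ constForms r τ) (x : Site 4 L)
    (l j : Fin 4) :
    exp (lieIso r.ρ (C (x, j))) = r.ρ (τ (x, l)) * exp (lieIso r.ρ (C (x.shift l, j))) * r.ρ (τ (x, l))⁻¹ := by
  rw [← exp_lieIso_adFib, adFib_apply_of_mem_constForms r hC]

/-- Same for the negatives. -/
theorem exp_neg_const_covariant {τ : GaugeConfig 4 L G} {C : OneForm r L} (hC : C ∈ constForms r τ) (x : Site 4 L)
    (l j : Fin 4) :
    exp (-lieIso r.ρ (C (x, j))) = r.ρ (τ (x, l)) * exp (-lieIso r.ρ (C (x.shift l, j))) * r.ρ (τ (x, l))⁻¹ := by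
  rw [← exp_neg_lieIso_adFib, adFib_apply_of_mem_constForms r hC]

/-- **The commutator field of a constant form is covariantly constant**:
`α(x) = ρτ(x,l) α(x+e_l) ρτ(x,l)⁻¹` for `α(x) = e^{c_i(x)} e^{c_j(x)} e^{−c_i(x)} e^{−c_j(x)} − 1`. -/
theorem comm_covariant {τ : GaugeConfig 4 L G} {C : OneForm r L} (hC : C ∈ constForms r τ) (i j l : Fin 4) (x : Site 4 L) :
    exp (lieIso r.ρ (C (x, i))) * exp (lieIso r.ρ (C (x, j))) * exp (-lieIso r.ρ (C (x, i))) * exp (-lieIso r.ρ (C (x, j))) - 1 =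
      r.ρ (τ (x, l)) *
          (exp (lieIso r.ρ (C (x.shift l, i))) * exp (lieIso r.ρ (C (x.shift l, j))) * exp (-lieIso r.ρ (C (x.shift l, i))) *
              exp (-lieIso r.ρ (C (x.shift l, j))) - 1) *
        r.ρ (τ (x, l))⁻¹ := by
  rw [exp_const_covariant r hC x l i, exp_const_covariant r hC x l j, exp_neg_const_covariant r hC x l i,
    exp_neg_const_covariant r hC x l j]
  simp only [Matrix.mul_sub, Matrix.sub_mul, Matrix.mul_one, rho_mul_inv, Matrix.mul_assoc]
  congr 1
  simp only [← Matrix.mul_assoc]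
  rw [Matrix.mul_assoc _ (r.ρ (τ (x, l))⁻¹) (r.ρ (τ (x, l))), rho_inv_mul, Matrix.mul_one,
    Matrix.mul_assoc _ (r.ρ (τ (x, l))⁻¹) (r.ρ (τ (x, l))), rho_inv_mul, Matrix.mul_one,
    Matrix.mul_assoc _ (r.ρ (τ (x, l))⁻¹) (r.ρ (τ (x, l))), rho_inv_mul, Matrix.mul_one]

/-- **The cross term vanishes**: `Σ_x Re tr(α(x)ᴴ · M (dOne τ B i j x)) = 0` for the commutator field of a constant form. -/
theorem sum_re_trace_comm_dOne : ∀ {G : Type} [Group G] [TopologicalSpace G] [CompactSpace G] (r : Literature.MathematicalPhysics.QuantumFieldTheory.LatticeRep G) {L : ℕ} [NeZero L] {τ : Literature.MathematicalPhysics.QuantumFieldTheory.GaugeConfig 4 L G} {C : Summit.QuantumFields.YangMills.Theorems.FemtoCurvatureTwoPointC.Doubling.OneForm r L}, C ∈ Summit.QuantumFields.YangMills.Theorems.FemtoCurvatureTwoPointC.Doubling.constForms r τ → ∀ (B : Summit.QuantumFields.YangMills.Theorems.FemtoCurvatureTwoPointC.Doubling.OneForm r L) (i j : Fin 4), ∑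 x : Literature.MathematicalPhysics.QuantumFieldTheory.Site 4 L, ((NormedSpace.exp (Summit.QuantumFields.YangMills.Theorems.FreeEnergyLogCoefficient.lieIso r.ρ (C (x, i))) * NormedSpace.exp (Summit.QuantumFields.YangMills.Theorems.FreeEnergyLogCoefficient.lieIso r.ρ (C (x, j))) * NormedSpace.exp (-Summit.QuantumFields.YangMills.Theorems.FreeEnergyLogCoefficient.lieIso r.ρ (C (x, i))) * NormedSpace.exp (-Summit.QuantumFields.YangMills.Theorems.FreeEnergyLogCoefficient.lieIso r.ρ (C (x, j))) - 1)ᴴ * Summit.QuantumFields.YangMills.Theorems.FreeEnergyLogCoefficient.lieIso r.ρ (Summit.QuantumFields.YangMills.Theorems.FemtoCurvatureTwoPointC.Doubling.dOne r τ B i j x)).trace.re = 0 := by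
  intro G _ _ _ r L _ τ C hC B i j
  exact sum_re_trace_conjTranspose_mul_dOne r τ _ (comm_covariant r hC i j i) (comm_covariant r hC i j j) B

/-! ### The per-plaquette decomposition -/

/-- **Per-plaquette decomposition.** At a flat plaquette, for `C ∈ constForms τ` and any `B` with all link variables of norm
`≤ 1/4`: `‖(ρ U_{x;ij}(cfg τ (C+B)) − 1) − α − β‖ ≤ 3 σ (b₁+b₂+b₃+b₄)` with `α` the commutator of the zero modes,
`β = M (dOne τ B i j x)`, `σ = 2‖C(x,i)‖ + 2‖C(x,j)‖ + (b₁+b₂+b₃+b₄)`, `b₁ = ‖B(x,i)‖`, `b₂ = ‖B(x+e_i,j)‖`, `b₃ = ‖B(x+e_j,i)‖`,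
`b₄ = ‖B(x,j)‖`. -/
theorem norm_hol_sub_one_sub_sub_le {τ : GaugeConfig 4 L G} {x : Site 4 L} {i j : Fin 4}
    (hτx : plaquetteHolonomy τ x i j = 1) {C : OneForm r L} (hC : C ∈ constForms r τ) (B : OneForm r L)
    (hCi : ‖C (x, i)‖ ≤ 1 / 4) (hCj : ‖C (x, j)‖ ≤ 1 / 4) (hB₁ : ‖B (x, i)‖ ≤ 1 / 4) (hB₂ : ‖B (x.shift i, j)‖ ≤ 1 / 4)
    (hB₃ : ‖B (x.shift j, i)‖ ≤ 1 / 4) (hB₄ : ‖B (x, j)‖ ≤ 1 / 4) :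
    ‖(r.ρ (plaquetteHolonomy (cfg r τ (C + B)) x i j) - 1) -
        (exp (lieIso r.ρ (C (x, i))) * exp (lieIso r.ρ (C (x, j))) * exp (-lieIso r.ρ (C (x, i))) *
            exp (-lieIso r.ρ (C (x, j))) - 1) -
        lieIso r.ρ (dOne r τ B i j x)‖ ≤
      3 * (2 * ‖C (x, i)‖ + 2 * ‖C (x, j)‖ + (‖B (x, i)‖ + ‖B (x.shift i, j)‖ + ‖B (x.shift j, i)‖ + ‖B (x, j)‖)) *
        (‖B (x, i)‖ + ‖B (x.shift i, j)‖ + ‖B (x.shift j, i)‖ + ‖B (x, j)‖) := by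
  -- the four link variables, split into zero-mode and massive parts
  set c₁ := lieIso r.ρ (C (x, i)) with hc₁
  set c₂ := lieIso r.ρ (C (x, j)) with hc₂
  set b₁ := lieIso r.ρ (B (x, i)) with hb₁
  set b₂ := lieIso r.ρ (adFib r (τ (x, i)) (B (x.shift i, j))) with hb₂
  set b₃ := lieIso r.ρ (adFib r (τ (x, j)) (B (x.shift j, i))) with hb₃
  set b₄ := lieIso r.ρ (B (x, j)) with hb₄
  have hhol : r.ρ (plaquetteHolonomy (cfg r τ (C + B)) x i j) =
      exp (c₁ + b₁) * exp (c₂ + b₂) * exp (-c₁ + -b₃) * exp (-c₂ + -b₄) := by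
    rw [rho_plaquetteHolonomy_cfg r hτx (C + B)]
    simp only [PiLp.add_apply, map_add, lieIso_adFib_const r hC, neg_add]
    rw [← hc₁, ← hc₂, ← hb₁, ← hb₂, ← hb₃, ← hb₄]
  have hβ : lieIso r.ρ (dOne r τ B i j x) = b₁ + b₂ + -b₃ + -b₄ := by
    rw [dOne_apply, map_sub, map_sub, map_sub]; abel
  rw [hhol, hβ]
  -- skewness and norms
  have sk : ∀ a : Fib r, (lieIso r.ρ a)ᴴ = -lieIso r.ρ a := conjTranspose_lieIso r.ρ
  have skn : ∀ a : Fib r, (-lieIso r.ρ a)ᴴ = -(-lieIso r.ρ a) := fun a => by rw [Matrix.conjTranspose_neg, sk]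
  have k1 : ‖c₁‖ = ‖C (x, i)‖ := by rw [hc₁, norm_lieIso]
  have k2 : ‖c₂‖ = ‖C (x, j)‖ := by rw [hc₂, norm_lieIso]
  have n1 : ‖c₁‖ ≤ 1 / 4 := by rw [k1]; exact hCi
  have n2 : ‖c₂‖ ≤ 1 / 4 := by rw [k2]; exact hCj
  have n3 : ‖-c₁‖ ≤ 1 / 4 := by rw [norm_neg]; exact n1
  have n4 : ‖-c₂‖ ≤ 1 / 4 := by rw [norm_neg]; exact n2
  have m1 : ‖b₁‖ = ‖B (x, i)‖ := by rw [hb₁, norm_lieIso]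
  have m2 : ‖b₂‖ = ‖B (x.shift i, j)‖ := by rw [hb₂, norm_lieIso, LinearIsometry.norm_map]
  have m3 : ‖-b₃‖ = ‖B (x.shift j, i)‖ := by rw [norm_neg, hb₃, norm_lieIso, LinearIsometry.norm_map]
  have m4 : ‖-b₄‖ = ‖B (x, j)‖ := by rw [norm_neg, hb₄, norm_lieIso]
  have key := ConeAlgebra.norm_prod_exp_sub_prod_exp_sub_sum_le (sk _) (sk _) (skn _) (skn _) (sk _) (sk _) (skn _)
    n1 n2 n3 n4 (by rw [m1]; exact hB₁) (by rw [m2]; exact hB₂) (by rw [m3]; exact hB₃) (by rw [m4]; exact hB₄)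
  rw [m1, m2, m3, m4, norm_neg c₁, norm_neg c₂, k1, k2] at key
  have e : exp (c₁ + b₁) * exp (c₂ + b₂) * exp (-c₁ + -b₃) * exp (-c₂ + -b₄) - 1 -
      (exp c₁ * exp c₂ * exp (-c₁) * exp (-c₂) - 1) - (b₁ + b₂ + -b₃ + -b₄) =
      exp (c₁ + b₁) * exp (c₂ + b₂) * exp (-c₁ + -b₃) * exp (-c₂ + -b₄) - exp c₁ * exp c₂ * exp (-c₁) * exp (-c₂) -
        (b₁ + b₂ + -b₃ + -b₄) := by abel
  rw [e]
  refine key.trans (le_of_eq ?_)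
  ring

/-! ### Per-plaquette consequences -/

omit [CompactSpace G] in
/-- **Per-plaquette lower bound**: `‖ρU − 1‖² ≥ ½‖α + β‖² − ‖ℰ‖²` with `ℰ = (ρU − 1) − α − β`. -/
theorem half_norm_add_sq_sub_le_norm_sub_one_sq (U αm βm : Matrix (Fin r.N) (Fin r.N) ℂ) :
    ‖αm + βm‖ ^ 2 / 2 - ‖(U - 1) - αm - βm‖ ^ 2 ≤ ‖U - 1‖ ^ 2 := by
  have h := ConeAlgebra.half_sq_sub_sq_le_norm_add_sq (αm + βm) ((U - 1) - αm - βm)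
  rwa [show αm + βm + ((U - 1) - αm - βm) = U - 1 by abel] at h

omit [CompactSpace G] in
/-- **Per-plaquette upper bound**: `‖ρU − 1‖² ≤ 3 (‖α‖² + ‖β‖² + ‖ℰ‖²)`. -/
theorem norm_sub_one_sq_le_three_mul (U αm βm : Matrix (Fin r.N) (Fin r.N) ℂ) :
    ‖U - 1‖ ^ 2 ≤ 3 * (‖αm‖ ^ 2 + ‖βm‖ ^ 2 + ‖(U - 1) - αm - βm‖ ^ 2) := by
  have h := ConeAlgebra.norm_add_add_sq_le αm βm ((U - 1) - αm - βm)
  rwa [show αm + βm + ((U - 1) - αm - βm) = U - 1 by abel] at h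

omit [CompactSpace G] in
/-- The commutator of the zero modes against the bracket: `(1/16) ‖[c_i, c_j]‖² ≤ ‖α‖²` (from `stub_expCommutatorBracket`). -/
theorem bracket_sq_le_comm_sq {a b : Matrix (Fin r.N) (Fin r.N) ℂ} (ha : aᴴ = -a) (hb : bᴴ = -b) (na : ‖a‖ ≤ 1 / 4)
    (nb : ‖b‖ ≤ 1 / 4) :
    ‖a * b - b * a‖ ^ 2 / 16 ≤ ‖exp a * exp b * exp (-a) * exp (-b) - 1‖ ^ 2 := by
  have h := ((stub_expCommutatorBracket r.N a b ha hb).2 na nb)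
  have h0 : 0 ≤ 1 / 4 * ‖a * b - b * a‖ := by positivity
  have h2 := pow_le_pow_left₀ h0 h 2
  nlinarith [h2]

omit [CompactSpace G] in
/-- … and `‖α‖² ≤ ‖[c_i, c_j]‖²`. -/
theorem comm_sq_le_bracket_sq {a b : Matrix (Fin r.N) (Fin r.N) ℂ} (ha : aᴴ = -a) (hb : bᴴ = -b) :
    ‖exp a * exp b * exp (-a) * exp (-b) - 1‖ ^ 2 ≤ ‖a * b - b * a‖ ^ 2 :=
  pow_le_pow_left₀ (norm_nonneg _) (stub_expCommutatorBracket r.N a b ha hb).1 2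

end Summit.QuantumFields.YangMills.Theorems.FemtoCurvatureTwoPointC.Doubling

end
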